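import Summits.CriticalPhenomena.PercolationContinuityZ3.Theorems.PercNearOneGluingNoHeavyLowerTailSuperTerminalP3LamAFreePieces
import HarnessLib

/-!
# The gluing criterion `C(γ)` of an `a`-free piece is stable under parallel composition (cell algebra)

Support file for crux `stmt-CriticalPhenomena-4575` (`NoHeavyLowerTail`), seat `prim-l12-p1` gen 33 (`--supports stmt-CriticalPhenomena-4575`);
sequel of `…SuperTerminalP3LamAFreePieces`.  No definitions, no sorries, standard axioms.

`…AFreePieces.dvec_p3lam_mul_aFree` says: if `d` satisfies the order relations and the row `P3_λ`, and the `a`-free piece `e = (n, n, N₂, N₂, N₄, N₄, n, ic)`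
satisfies the criterion `C(d7; n, N₂, N₄, ic)`, then `d ⊙ e` satisfies the row.  Here we record the converse half of the Farkas duality and its consequence:

* `crit_iff_rayRows` — **`C(γ; e)` is literally the row of `r ⊙ e` for the two extreme rays** `r_τ(γ) = (0, A, A, 0, A+B, 0, 0, γ)` and
  `r_ζ(γ) = (0, A, A+B, 0, A, 0, 0, γ)` (`A = λ−1+γ`, `B = 1−γ`) of the cone `{cells ≥ 0, Row_λ ≥ 0, d7 = γ}` (both rays satisfy the order relations and the
  row with equality);
* `crit_mul` — **parallel stability: if `e` satisfies `C(γ; e)` and `f` satisfies `C(γ·ic_e; f)`, then the coordinatewise product `e ⊙ f` (again of `a`-free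
  shape) satisfies `C(γ; e ⊙ f)`** — glue `f` onto `r ⊙ e` with `dvec_p3lam_mul_aFree`.
Since the down-set vector of the union of two `{s,b,c}`-gadgets glued along all three terminals is the product of their vectors (`real_partLE_partialUnion`),
CONJECTURE AF_λ of memo `FROM-prim-l12-p1-g33-PORT-PART-SHARP-ROW.md` §9 (`C(γ)` for all `γ ∈ [0,1]` on every finite weighted 3-terminal graph) reduces to
`{s,b,c}`-prime gadgets; by contrast the face inequality `(C½) = C(1)` alone is NOT parallel-stable at the cell level (abstract counterexamples, memo §9.3(g)).
-/

namespace Summit.CriticalPhenomena.PercolationContinuityZ3.Theorems.SuperTerminalP3LamAFreeJoin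

open SuperTerminalP3LamAFreePieces

/-- The ORDER RELATIONS of a down-set vector (as in `…SuperTerminalP3LamDvec`).  Local notation only. -/
local notation "Core[" x0 "," x1 "," x2 "," x3 "," x4 "," x5 "," x6 "," x7 "]" =>
  (((0 : ℝ) ≤ x0 ∧ x0 ≤ x1 ∧ x0 ≤ x3 ∧ x0 ≤ x5 ∧ x0 ≤ x6 ∧ (0 : ℝ) ≤ x7 ∧ x7 ≤ 1 ∧
      (0 : ℝ) ≤ x2 - x3 - x1 + x0 ∧ (0 : ℝ) ≤ x4 - x5 - x6 + x0 - x1 + x0) : Prop)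

/-- The row `P3_λ` in down-set coordinates (as in `…SuperTerminalP3LamDvec`).  Local notation only. -/
local notation "RowLam[" lam ";" x0 "," x1 "," x2 "," x3 "," x4 "," x5 "," x6 "," x7 "]" =>
  (((x2 - x3 + x4 - x5 - x6 - x1 + 2 * x0) * (1 - x7) ≤ lam * (x2 - x3 + x4 - x5 - x6 - 2 * x1 + 3 * x0)) : Prop)

/-- The gluing criterion `C(γ; n, N₂, N₄, ic)` of an `a`-free piece (as in `…SuperTerminalP3LamAFreePieces`).  Local notation only. -/
local notation "Crit[" lam ";" g ";" n "," N2 "," N4 "," ic "]" =>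
  (((lam - 1 + g) * (n * (1 - g * ic) - (lam - 1 + g * ic) * (N2 + N4 - 2 * n)) ≤ (1 - g) * (lam - 1 + g * ic) * N2 ∧
      (lam - 1 + g) * (n * (1 - g * ic) - (lam - 1 + g * ic) * (N2 + N4 - 2 * n)) ≤ (1 - g) * (lam - 1 + g * ic) * N4) : Prop)

/-- **The criterion is the row at the two extreme rays.**  For every `λ, γ` and every `a`-free shape `(n, N₂, N₄, ic)`:
`C(γ; n, N₂, N₄, ic)` holds iff the coordinatewise products of `(n, n, N₂, N₂, N₄, N₄, n, ic)` with the rays `r_ζ = (0, A, A+B, 0, A, 0, 0, γ)` and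
`r_τ = (0, A, A, 0, A+B, 0, 0, γ)` (`A = λ−1+γ`, `B = 1−γ`) satisfy the row `P3_λ` (two polynomial identities). [this work] -/
theorem crit_iff_rayRows (lam g n N2 N4 ic : ℝ) :
    Crit[lam; g; n, N2, N4, ic] ↔
      (RowLam[lam; 0 * n, (lam - 1 + g) * n, (lam - 1 + g + (1 - g)) * N2, 0 * N2, (lam - 1 + g) * N4, 0 * N4, 0 * n, g * ic] ∧
        RowLam[lam; 0 * n, (lam - 1 + g) * n, (lam - 1 + g) * N2, 0 * N2, (lam - 1 + g + (1 - g)) * N4, 0 * N4, 0 * n, g * ic]) := by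
  have eζ : lam * ((lam - 1 + g + (1 - g)) * N2 - 0 * N2 + (lam - 1 + g) * N4 - 0 * N4 - 0 * n - 2 * ((lam - 1 + g) * n) + 3 * (0 * n)) -
      ((lam - 1 + g + (1 - g)) * N2 - 0 * N2 + (lam - 1 + g) * N4 - 0 * N4 - 0 * n - (lam - 1 + g) * n + 2 * (0 * n)) * (1 - g * ic) =
      (1 - g) * (lam - 1 + g * ic) * N2 - (lam - 1 + g) * (n * (1 - g * ic) - (lam - 1 + g * ic) * (N2 + N4 - 2 * n)) := by ring
  have eτ : lam * ((lam - 1 + g) * N2 - 0 * N2 + (lam - 1 + g + (1 - g)) * N4 - 0 * N4 - 0 * n - 2 * ((lam - 1 + g) * n) + 3 * (0 * n)) -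
      ((lam - 1 + g) * N2 - 0 * N2 + (lam - 1 + g + (1 - g)) * N4 - 0 * N4 - 0 * n - (lam - 1 + g) * n + 2 * (0 * n)) * (1 - g * ic) =
      (1 - g) * (lam - 1 + g * ic) * N4 - (lam - 1 + g) * (n * (1 - g * ic) - (lam - 1 + g * ic) * (N2 + N4 - 2 * n)) := by ring
  constructor
  · rintro ⟨h2, h4⟩
    constructor <;> linarith
  · rintro ⟨hζ, hτ⟩
    constructor <;> linarith

/-- The ray `r_ζ ⊙ e` satisfies the order relations (for an `a`-free shape with `0 ≤ n ≤ N₂`, `n ≤ N₄`, `0 ≤ ic ≤ 1`, `0 ≤ γ ≤ 1`, `λ ≥ 1`). [this work] -/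
theorem core_rayZeta {lam g n N2 N4 ic : ℝ} (hlam : 1 ≤ lam) (hg : 0 ≤ g) (hg1 : g ≤ 1) (hn : 0 ≤ n) (h2 : n ≤ N2) (h4 : n ≤ N4)
    (hic : 0 ≤ ic) (hic1 : ic ≤ 1) :
    Core[0 * n, (lam - 1 + g) * n, (lam - 1 + g + (1 - g)) * N2, 0 * N2, (lam - 1 + g) * N4, 0 * N4, 0 * n, g * ic] := by
  have hA : 0 ≤ lam - 1 + g := by linarith
  refine ⟨by simp, by simpa using mul_nonneg hA hn, by simp, by simp, by simp, mul_nonneg hg hic, ?_, ?_, ?_⟩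
  · calc g * ic ≤ 1 * 1 := mul_le_mul hg1 hic1 hic zero_le_one
      _ = 1 := by ring
  · have h1 : (lam - 1 + g) * n ≤ (lam - 1 + g) * N2 := mul_le_mul_of_nonneg_left h2 hA
    have h3 : 0 ≤ (1 - g) * N2 := mul_nonneg (by linarith) (hn.trans h2)
    nlinarith
  · have h1 : (lam - 1 + g) * n ≤ (lam - 1 + g) * N4 := mul_le_mul_of_nonneg_left h4 hA
    nlinarith

/-- The ray `r_τ ⊙ e` satisfies the order relations. [this work] -/
theorem core_rayTau {lam g n N2 N4 ic : ℝ} (hlam : 1 ≤ lam) (hg : 0 ≤ g) (hg1 : g ≤ 1) (hn : 0 ≤ n) (h2 : n ≤ N2) (h4 : n ≤ N4)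
    (hic : 0 ≤ ic) (hic1 : ic ≤ 1) :
    Core[0 * n, (lam - 1 + g) * n, (lam - 1 + g) * N2, 0 * N2, (lam - 1 + g + (1 - g)) * N4, 0 * N4, 0 * n, g * ic] := by
  have hA : 0 ≤ lam - 1 + g := by linarith
  refine ⟨by simp, by simpa using mul_nonneg hA hn, by simp, by simp, by simp, mul_nonneg hg hic, ?_, ?_, ?_⟩
  · calc g * ic ≤ 1 * 1 := mul_le_mul hg1 hic1 hic zero_le_one
      _ = 1 := by ring
  · have h1 : (lam - 1 + g) * n ≤ (lam - 1 + g) * N2 := mul_le_mul_of_nonneg_left h2 hA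
    nlinarith
  · have h1 : (lam - 1 + g) * n ≤ (lam - 1 + g) * N4 := mul_le_mul_of_nonneg_left h4 hA
    have h3 : 0 ≤ (1 - g) * N4 := mul_nonneg (by linarith) (hn.trans h4)
    nlinarith

/-- **Parallel stability of the criterion (cell level).**  For `λ > 1`, `γ ∈ [0,1]` and two `a`-free shapes `e = (n, N₂, N₄, ic)`, `f = (n′, N₂′, N₄′, ic′)`
(`0 ≤ n ≤ N₂, N₄`, `0 ≤ ic ≤ 1`, same for `f`): `C(γ; e)` and `C(γ·ic; f)` imply `C(γ; e ⊙ f)` for the product shape `(n n′, N₂N₂′, N₄N₄′, ic·ic′)`.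
Proof: by `crit_iff_rayRows`, `C(γ; e)` says that `r ⊙ e` satisfies the row for both extreme rays `r`; these vectors satisfy the order relations
(`core_rayZeta/Tau`) and have port coordinate `γ·ic`, so `dvec_p3lam_mul_aFree` glues `f` onto them; the results are the rows of `r ⊙ (e ⊙ f)`. [this work] -/
theorem crit_mul {lam g n N2 N4 ic n' N2' N4' ic' : ℝ} (hlam : 1 < lam) (hg : 0 ≤ g) (hg1 : g ≤ 1)
    (hn : 0 ≤ n) (h2 : n ≤ N2) (h4 : n ≤ N4) (hic : 0 ≤ ic) (hic1 : ic ≤ 1)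
    (hn' : 0 ≤ n') (h2' : n' ≤ N2') (h4' : n' ≤ N4') (hic' : 0 ≤ ic')
    (he : Crit[lam; g; n, N2, N4, ic]) (hf : Crit[lam; g * ic; n', N2', N4', ic']) :
    Crit[lam; g; n * n', N2 * N2', N4 * N4', ic * ic'] := by
  obtain ⟨hζ, hτ⟩ := (crit_iff_rayRows lam g n N2 N4 ic).1 he
  rw [crit_iff_rayRows]
  constructor
  · have h := dvec_p3lam_mul_aFree (e1 := n') (e3 := N2') (e5 := N4') (e6 := n') hlam
      (core_rayZeta hlam.le hg hg1 hn h2 h4 hic hic1) hζ rfl rfl rfl rfl hn' h2' h4' hic' hf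
    convert h using 2 <;> ring
  · have h := dvec_p3lam_mul_aFree (e1 := n') (e3 := N2') (e5 := N4') (e6 := n') hlam
      (core_rayTau hlam.le hg hg1 hn h2 h4 hic hic1) hτ rfl rfl rfl rfl hn' h2' h4' hic' hf
    convert h using 2 <;> ring

end Summit.CriticalPhenomena.PercolationContinuityZ3.Theorems.SuperTerminalP3LamAFreeJoin
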